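import Literature.Analysis.FluidPDE.JetDerivativeEstimates
import HarnessLib

/-!
# The intermittent-jet perturbation: time derivatives of the velocity (BV §7.5.4, §7.6.2)

Analysis/FluidPDE support file (everything proved): the time derivative of
`wpc = w^{(p)} + w^{(c)}` of `JetPerturbation` on the slab `[0, T]`, its pointwise majorant by
the blocks of `Jet.Bounds`, and the resulting sup bound (for (2.3) of Buckmaster–Vicol,
Ann. of Math. 189 (2019), and for the sup size of the new stress); the sup bound of `∂ₜX`.
The vectors `k_x`, `∇φ̃_x` do not depend on time, so only the scalar factors are
differentiated: `∂ₜa` (`A₁`), `∂ₜη = ω η′`, `∂ₜη′ = ω η″` (`ω = |k|²σμ′`), `∂ₜ∂ⱼa` (`A₂`).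

## References

* T. Buckmaster, V. Vicol, EMS Surv. Math. Sci. 6 (2019) = arXiv:1901.09023, §7.5.4, §7.6.2 (7.49). [`BuckmasterVicol2020`]
* T. Buckmaster, V. Vicol, Ann. of Math. 189 (2019) = arXiv:1709.10033, §2 (2.3). [`BuckmasterVicol2019Annals`]
-/

noncomputable section

open MeasureTheory Set Filter Topology Function
open scoped InnerProductSpace ContDiff ENNReal NNReal

namespace Literature.Analysis.FluidPDE

namespace JetStep

open Literature.Analysis.FunctionSpaces FunctionSpaces.Torus Mikado NashGeometric Jet

local notation "𝕋³" => UnitAddTorus (Fin 3)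
local notation "E³" => EuclideanSpace ℝ (Fin 3)
local notation "Idx" => Index (Fin 3)

namespace Datum

variable {D : Datum} (h : D.Valid) {A₀ A₁ A₂ H₁ H₂ B : ℝ} (hA : D.AmpBounds A₀ A₁ A₂ H₁ H₂)
  (hB : ∀ x t, Jet.Bounds B (D.J x) D.s x t) (hB1 : 1 ≤ B)

/-- `ȧ`, `∂ₜ∂ⱼa` (one-sided time derivatives on `[0,T]`). [folklore] -/
def adot (D : Datum) (x : Idx) (t : ℝ) (y : 𝕋³) : ℝ := Torus.timeDerivWithin (Icc 0 D.T) (D.a x) t y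

/-- `∂ₜ∂ⱼa`. [folklore] -/
def dadot (D : Datum) (x : Idx) (j : Fin 3) (t : ℝ) (y : 𝕋³) : ℝ :=
  Torus.timeDerivWithin (Icc 0 D.T) (fun s z => Torus.partialDeriv j (D.a x s) z) t y

/-- The time derivatives of the four terms (formulas). [folklore] -/
def T1dot (D : Datum) (x : Idx) (t : ℝ) (y : 𝕋³) : E³ :=
  (D.adot x t y * (Jet.eta (D.J x) x t y * Jet.psiJ (D.J x) D.s x y) +
    D.a x t y * (((D.J x).om * Jet.etaD (D.J x) x t y) * Jet.psiJ (D.J x) D.s x y)) • dirVec x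

/-- `∂ₜT₂`. [folklore] -/
def T2dot (D : Datum) (x : Idx) (t : ℝ) (y : 𝕋³) : E³ :=
  (D.adot x t y * (((D.σ : ℝ) * dirNormSq x) * Jet.etaD (D.J x) x t y) +
    D.a x t y * (((D.σ : ℝ) * dirNormSq x) * ((D.J x).om * Jet.etaDD (D.J x) x t y))) • Torus.gradient (Jet.phiJ (D.J x) D.s x) y

/-- `ṁ = ∑ⱼ ∂ⱼφ̃ ∂ₜ∂ⱼa`. [folklore] -/
def mdot (D : Datum) (x : Idx) (t : ℝ) (y : 𝕋³) : ℝ := ∑ j, Torus.partialDeriv j (Jet.phiJ (D.J x) D.s x) y * D.dadot x j t y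

/-- `ṅ = ∑ⱼ kⱼ ∂ₜ∂ⱼa`. [folklore] -/
def ndot (D : Datum) (x : Idx) (t : ℝ) (y : 𝕋³) : ℝ := ∑ j, ((dir x j : ℤ) : ℝ) * D.dadot x j t y

/-- `∂ₜT₃`. [folklore] -/
def T3dot (D : Datum) (x : Idx) (t : ℝ) (y : 𝕋³) : E³ :=
  (((D.J x).om * Jet.etaD (D.J x) x t y) * D.mfun x t y + Jet.eta (D.J x) x t y * D.mdot x t y) • dirVec x

/-- `∂ₜT₄`. [folklore] -/
def T4dot (D : Datum) (x : Idx) (t : ℝ) (y : 𝕋³) : E³ :=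
  (((D.J x).om * Jet.etaD (D.J x) x t y) * D.nfun x t y + Jet.eta (D.J x) x t y * D.ndot x t y) • Torus.gradient (Jet.phiJ (D.J x) D.s x) y

include h

/-- `0 ≤ ω_x ≤ 5σμ′`. [folklore] -/
theorem om_le (x : Idx) : 0 ≤ (D.J x).om ∧ (D.J x).om ≤ 5 * D.σ * D.mup := by
  obtain ⟨hμ, hκ, hσ, hmup, -⟩ := pos h
  rw [J_om]
  have hd := dirNormSq_le' x
  have hd0 := (dirNormSq_pos x).le
  exact ⟨by positivity, by nlinarith [mul_nonneg hσ.le hmup.le]⟩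

/-- **The one-sided time derivatives of `T₁, …, T₄` on `[0,T]`**. [folklore] -/
theorem hasDerivWithinAt_terms (x : Idx) {t : ℝ} (ht : t ∈ Icc 0 D.T) (y : 𝕋³) :
    HasDerivWithinAt (fun s => D.T1 x s y) (D.T1dot x t y) (Icc 0 D.T) t ∧
    HasDerivWithinAt (fun s => D.T2 x s y) (D.T2dot x t y) (Icc 0 D.T) t ∧
    HasDerivWithinAt (fun s => D.T3 x s y) (D.T3dot x t y) (Icc 0 D.T) t ∧
    HasDerivWithinAt (fun s => D.T4 x s y) (D.T4dot x t y) (Icc 0 D.T) t := by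
  have hJ := Jvalid h x
  have hU := uniqueDiffOn h
  have ha : HasDerivWithinAt (fun s => D.a x s y) (D.adot x t y) (Icc 0 D.T) t := (smooth_a h x).hasDerivWithinAt_slice ht y
  have hη : HasDerivWithinAt (fun s => Jet.eta (D.J x) x s y) ((D.J x).om * Jet.etaD (D.J x) x t y) (Icc 0 D.T) t :=
    (Jet.hasDerivAt_eta hJ x y t).hasDerivWithinAt
  have hη' : HasDerivWithinAt (fun s => Jet.etaD (D.J x) x s y) ((D.J x).om * Jet.etaDD (D.J x) x t y) (Icc 0 D.T) t :=
    (Jet.hasDerivAt_etaD hJ x y t).hasDerivWithinAt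
  have hda : ∀ j, HasDerivWithinAt (fun s => Torus.partialDeriv j (D.a x s) y) (D.dadot x j t y) (Icc 0 D.T) t := fun j =>
    ((smooth_a h x).partialDeriv hU j).hasDerivWithinAt_slice ht y
  have hm : HasDerivWithinAt (fun s => D.mfun x s y) (D.mdot x t y) (Icc 0 D.T) t := by
    unfold Datum.mfun Datum.mdot
    exact HasDerivWithinAt.fun_sum fun j _ => (hda j).const_mul _
  have hn : HasDerivWithinAt (fun s => D.nfun x s y) (D.ndot x t y) (Icc 0 D.T) t := by
    unfold Datum.nfun Datum.ndot
    exact HasDerivWithinAt.fun_sum fun j _ => (hda j).const_mul _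
  refine ⟨?_, ?_, ?_, ?_⟩
  · have := (ha.mul (hη.mul_const (Jet.psiJ (D.J x) D.s x y))).smul_const (dirVec x)
    exact this.congr_deriv rfl
  · have := (ha.mul (hη'.const_mul ((D.σ : ℝ) * dirNormSq x))).smul_const (Torus.gradient (Jet.phiJ (D.J x) D.s x) y)
    exact this.congr_deriv rfl
  · have := (hη.mul hm).smul_const (dirVec x)
    exact this.congr_deriv rfl
  · have := (hη.mul hn).smul_const (Torus.gradient (Jet.phiJ (D.J x) D.s x) y)
    exact this.congr_deriv rfl

/-- **`∂ₜ wpc = ∑_x (∂ₜT₁ - ∂ₜT₂ + ∂ₜT₃ - ∂ₜT₄)`** on `[0,T]`. [folklore] -/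
theorem timeDerivWithin_wpc {t : ℝ} (ht : t ∈ Icc 0 D.T) (y : 𝕋³) :
    Torus.timeDerivWithin (Icc 0 D.T) D.wpc t y = ∑ x, (D.T1dot x t y - D.T2dot x t y + D.T3dot x t y - D.T4dot x t y) := by
  have key : HasDerivWithinAt (fun s => D.wpc s y) (∑ x, (D.T1dot x t y - D.T2dot x t y + D.T3dot x t y - D.T4dot x t y)) (Icc 0 D.T) t := by
    have h1 : HasDerivWithinAt (fun s => ∑ x, (D.T1 x s y - D.T2 x s y + D.T3 x s y - D.T4 x s y))
        (∑ x, (D.T1dot x t y - D.T2dot x t y + D.T3dot x t y - D.T4dot x t y)) (Icc 0 D.T) t := by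
      refine HasDerivWithinAt.fun_sum fun x _ => ?_
      obtain ⟨d1, d2, d3, d4⟩ := hasDerivWithinAt_terms h x ht y
      exact ((d1.sub d2).add d3).sub d4
    exact h1.congr (fun s hs => wpc_eq_terms h hs y) (wpc_eq_terms h ht y)
  exact key.derivWithin (uniqueDiffOn h t ht)

include hA

omit h in
/-- `|ȧ| ≤ A₁`, `|∂ₜ∂ⱼa| ≤ A₂`, `|ṁ| ≤ A₂ ∑|∂ⱼφ̃|`, `|ṅ| ≤ 9A₂`. [folklore] -/
theorem dot_bounds (x : Idx) {t : ℝ} (ht : t ∈ Icc 0 D.T) (y : 𝕋³) :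
    |D.adot x t y| ≤ A₁ ∧ (∀ j, |D.dadot x j t y| ≤ A₂) ∧
    |D.mdot x t y| ≤ A₂ * ∑ j, |Torus.partialDeriv j (Jet.phiJ (D.J x) D.s x) y| ∧ |D.ndot x t y| ≤ 9 * A₂ := by
  have h1 : |D.adot x t y| ≤ A₁ := hA.dta_le x t ht y
  have h2 : ∀ j, |D.dadot x j t y| ≤ A₂ := fun j => hA.dtda_le x t ht y j
  have hA2 := hA.hA₂
  refine ⟨h1, h2, ?_, ?_⟩
  · unfold Datum.mdot
    rw [Finset.mul_sum]
    refine (Finset.abs_sum_le_sum_abs _ _).trans (Finset.sum_le_sum fun j _ => ?_)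
    rw [abs_mul, mul_comm]; exact mul_le_mul_of_nonneg_right (h2 j) (abs_nonneg _)
  · unfold Datum.ndot
    calc |∑ j, ((dir x j : ℤ) : ℝ) * D.dadot x j t y| ≤ ∑ j, |((dir x j : ℤ) : ℝ) * D.dadot x j t y| := Finset.abs_sum_le_sum_abs _ _
      _ ≤ ∑ _j : Fin 3, 3 * A₂ := Finset.sum_le_sum fun j _ => by
          rw [abs_mul]; exact mul_le_mul (abs_dir_le x j) (h2 j) (abs_nonneg _) (by norm_num)
      _ = 9 * A₂ := by simp only [Finset.sum_const, Finset.card_univ, Fintype.card_fin, nsmul_eq_mul, Nat.cast_ofNat]; ring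

/-- **Pointwise majorant of `∂ₜ wpc`** by five blocks (`ω ≤ 5σμ′`):
`‖∂ₜwpc‖ ≤ ∑_x [3A₁|ηψ̃| + 15σμ′A₀|η′ψ̃| + 65σ²μ′... ]` — precisely the displayed sum. [folklore] -/
theorem norm_timeDerivWithin_wpc_le {t : ℝ} (ht : t ∈ Icc 0 D.T) (y : 𝕋³) :
    ‖Torus.timeDerivWithin (Icc 0 D.T) D.wpc t y‖ ≤ ∑ x,
      (3 * A₁ * (|Jet.eta (D.J x) x t y| * |Jet.psiJ (D.J x) D.s x y|) +
       15 * D.σ * D.mup * A₀ * (|Jet.etaD (D.J x) x t y| * |Jet.psiJ (D.J x) D.s x y|) +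
       (5 * D.σ + 60 * D.σ * D.mup) * A₁ * (|Jet.etaD (D.J x) x t y| * ∑ j, |Torus.partialDeriv j (Jet.phiJ (D.J x) D.s x) y|) +
       25 * D.σ ^ 2 * D.mup * A₀ * (|Jet.etaDD (D.J x) x t y| * ∑ j, |Torus.partialDeriv j (Jet.phiJ (D.J x) D.s x) y|) +
       12 * A₂ * (|Jet.eta (D.J x) x t y| * ∑ j, |Torus.partialDeriv j (Jet.phiJ (D.J x) D.s x) y|)) := by
  rw [timeDerivWithin_wpc h ht y]
  refine (norm_sum_le _ _).trans (Finset.sum_le_sum fun x _ => ?_)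
  obtain ⟨hom0, hom⟩ := om_le h x
  obtain ⟨hm0, -, hn0, -⟩ := mn_bounds h hA x ht 0 y
  obtain ⟨had, -, hmd, hnd⟩ := dot_bounds hA x ht y
  have hA0 := hA.hA₀; have hA1 := hA.hA₁; have hA2 := hA.hA₂
  have hσ0 : (0 : ℝ) ≤ D.σ := (pos h).2.2.1.le
  have hmup0 : (0 : ℝ) ≤ D.mup := (pos h).2.2.2.1.le
  have hk := CL22.norm_dirVec_le x
  have hd5 := dirNormSq_le' x
  have hd0 := (dirNormSq_pos x).le
  have ha0 := hA.a_le x t ht y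
  set η := Jet.eta (D.J x) x t y
  set η' := Jet.etaD (D.J x) x t y
  set η'' := Jet.etaDD (D.J x) x t y
  set ψ := Jet.psiJ (D.J x) D.s x y
  set Sφ := ∑ j, |Torus.partialDeriv j (Jet.phiJ (D.J x) D.s x) y| with hSφ
  have hSφ0 : 0 ≤ Sφ := Finset.sum_nonneg fun _ _ => abs_nonneg _
  have hgφ : ‖Torus.gradient (Jet.phiJ (D.J x) D.s x) y‖ ≤ Sφ := norm_gradient_le ((isSmooth_phiJ h x).isContDiff (by simp)) y
  set om := (D.J x).om
  -- the four terms
  have b1 : ‖D.T1dot x t y‖ ≤ 3 * (A₁ * (|η| * |ψ|) + A₀ * (5 * D.σ * D.mup) * (|η'| * |ψ|)) := by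
    unfold Datum.T1dot
    rw [norm_smul, Real.norm_eq_abs]
    have : |D.adot x t y * (η * ψ) + D.a x t y * (om * η' * ψ)| ≤ A₁ * (|η| * |ψ|) + A₀ * (5 * D.σ * D.mup) * (|η'| * |ψ|) := by
      refine (abs_add_le _ _).trans (add_le_add ?_ ?_)
      · rw [abs_mul, abs_mul]; exact mul_le_mul_of_nonneg_right had (by positivity)
      · rw [abs_mul, abs_mul, abs_mul, abs_of_nonneg hom0]
        calc |D.a x t y| * (om * |η'| * |ψ|) ≤ A₀ * (5 * D.σ * D.mup * |η'| * |ψ|) :=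
              mul_le_mul ha0 (mul_le_mul_of_nonneg_right (mul_le_mul_of_nonneg_right hom (abs_nonneg _)) (abs_nonneg _))
                (by positivity) hA0
          _ = _ := by ring
    calc |D.adot x t y * (η * ψ) + D.a x t y * (om * η' * ψ)| * ‖dirVec x‖
        ≤ (A₁ * (|η| * |ψ|) + A₀ * (5 * D.σ * D.mup) * (|η'| * |ψ|)) * 3 := mul_le_mul this hk (norm_nonneg _) (by positivity)
      _ = _ := by ring
  have b2 : ‖D.T2dot x t y‖ ≤ 5 * D.σ * (A₁ * |η'| + A₀ * (5 * D.σ * D.mup) * |η''|) * Sφ := by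
    unfold Datum.T2dot
    rw [norm_smul, Real.norm_eq_abs]
    set c : ℝ := (D.σ : ℝ) * dirNormSq x with hcdef
    have hc : |c| ≤ 5 * D.σ := by rw [hcdef, abs_of_nonneg (by positivity)]; nlinarith
    have s1 : |D.adot x t y * (c * η')| ≤ A₁ * (5 * D.σ * |η'|) := by
      rw [abs_mul, abs_mul]
      exact mul_le_mul had (mul_le_mul_of_nonneg_right hc (abs_nonneg _)) (by positivity) hA1
    have s2 : |D.a x t y * (c * (om * η''))| ≤ A₀ * (5 * D.σ * (5 * D.σ * D.mup * |η''|)) := by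
      rw [abs_mul, abs_mul, abs_mul om, abs_of_nonneg hom0]
      refine mul_le_mul ha0 (mul_le_mul hc ?_ (by positivity) (by positivity)) (by positivity) hA0
      exact mul_le_mul_of_nonneg_right hom (abs_nonneg _)
    have : |D.adot x t y * (c * η') + D.a x t y * (c * (om * η''))| ≤ 5 * D.σ * (A₁ * |η'| + A₀ * (5 * D.σ * D.mup) * |η''|) := by
      refine (abs_add_le _ _).trans ((add_le_add s1 s2).trans (le_of_eq ?_))
      ring
    exact mul_le_mul this hgφ (norm_nonneg _) (by positivity)
  have b3 : ‖D.T3dot x t y‖ ≤ 3 * ((5 * D.σ * D.mup) * |η'| * (A₁ * Sφ) + |η| * (A₂ * Sφ)) := by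
    unfold Datum.T3dot
    rw [norm_smul, Real.norm_eq_abs]
    have : |om * η' * D.mfun x t y + η * D.mdot x t y| ≤ (5 * D.σ * D.mup) * |η'| * (A₁ * Sφ) + |η| * (A₂ * Sφ) := by
      refine (abs_add_le _ _).trans (add_le_add ?_ ?_)
      · rw [abs_mul, abs_mul, abs_of_nonneg hom0]
        exact mul_le_mul (mul_le_mul_of_nonneg_right hom (abs_nonneg _)) hm0 (abs_nonneg _) (by positivity)
      · rw [abs_mul]; exact mul_le_mul_of_nonneg_left hmd (abs_nonneg _)
    calc _ ≤ ((5 * D.σ * D.mup) * |η'| * (A₁ * Sφ) + |η| * (A₂ * Sφ)) * 3 := mul_le_mul this hk (norm_nonneg _) (by positivity)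
      _ = _ := by ring
  have b4 : ‖D.T4dot x t y‖ ≤ ((5 * D.σ * D.mup) * |η'| * (9 * A₁) + |η| * (9 * A₂)) * Sφ := by
    unfold Datum.T4dot
    rw [norm_smul, Real.norm_eq_abs]
    have : |om * η' * D.nfun x t y + η * D.ndot x t y| ≤ (5 * D.σ * D.mup) * |η'| * (9 * A₁) + |η| * (9 * A₂) := by
      refine (abs_add_le _ _).trans (add_le_add ?_ ?_)
      · rw [abs_mul, abs_mul, abs_of_nonneg hom0]
        exact mul_le_mul (mul_le_mul_of_nonneg_right hom (abs_nonneg _)) hn0 (abs_nonneg _) (by positivity)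
      · rw [abs_mul]; exact mul_le_mul_of_nonneg_left hnd (abs_nonneg _)
    exact mul_le_mul this hgφ (norm_nonneg _) (by positivity)
  calc ‖D.T1dot x t y - D.T2dot x t y + D.T3dot x t y - D.T4dot x t y‖
      ≤ ‖D.T1dot x t y‖ + ‖D.T2dot x t y‖ + ‖D.T3dot x t y‖ + ‖D.T4dot x t y‖ :=
        (norm_sub_le _ _).trans (add_le_add ((norm_add_le _ _).trans (add_le_add (norm_sub_le _ _) le_rfl)) le_rfl)
    _ ≤ _ := by
        refine (add_le_add (add_le_add (add_le_add b1 b2) b3) b4).trans (le_of_eq ?_)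
        ring

include hB hB1

/-- **Sup bound of `∂ₜ wpc`** (also the sup size of `f₁`). [cite: BuckmasterVicol2019Annals, §2 (2.3)] -/
theorem norm_timeDerivWithin_wpc_le_sup {t : ℝ} (ht : t ∈ Icc 0 D.T) (y : 𝕋³) :
    ‖Torus.timeDerivWithin (Icc 0 D.T) D.wpc t y‖ ≤ NN *
      (3 * A₁ * (B ^ 2 * D.κ ^ (1 / 2 : ℝ) * D.μ) + 15 * D.σ * D.mup * A₀ * (B ^ 2 * D.κ ^ (3 / 2 : ℝ) * D.μ) +
       (5 * D.σ + 60 * D.σ * D.mup) * A₁ * (3 * B ^ 2 * D.κ ^ (3 / 2 : ℝ) * (D.σ : ℝ)⁻¹) +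
       25 * D.σ ^ 2 * D.mup * A₀ * (3 * B ^ 2 * D.κ ^ (5 / 2 : ℝ) * (D.σ : ℝ)⁻¹) + 12 * A₂ * (3 * B ^ 2 * D.κ ^ (1 / 2 : ℝ) * (D.σ : ℝ)⁻¹)) := by
  obtain ⟨hμ, hκ, hσ, hmup, -⟩ := pos h
  have hA0 := hA.hA₀; have hA1 := hA.hA₁; have hA2 := hA.hA₂
  have hB0 : 0 ≤ B := by linarith
  refine (norm_timeDerivWithin_wpc_le h hA ht y).trans (sum_le_NN_mul fun x => ?_)
  have hJσ : ((D.J x).σ : ℝ) = D.σ := rfl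
  have hJμ : (D.J x).μ = D.μ := rfl
  have hJκ : (D.J x).κ = D.κ := rfl
  have e0 := (hB x t).eta_le y
  have e1 := (hB x t).etaD_le y
  have e2 := (hB x t).etaDD_le y
  have p0 := (hB x t).psiJ_le y
  have q1 := fun j => (hB x t).partialDeriv_phiJ_le j y
  simp only [hJσ, hJμ, hJκ] at e0 e1 e2 p0 q1
  have hSφ : ∑ j, |Torus.partialDeriv j (Jet.phiJ (D.J x) D.s x) y| ≤ 3 * (B * (D.σ : ℝ)⁻¹) :=
    (Finset.sum_le_sum fun j _ => q1 j).trans (le_of_eq (by simp only [Finset.sum_const, Finset.card_univ, Fintype.card_fin, nsmul_eq_mul, Nat.cast_ofNat]))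
  have hS0 : 0 ≤ ∑ j, |Torus.partialDeriv j (Jet.phiJ (D.J x) D.s x) y| := Finset.sum_nonneg fun _ _ => abs_nonneg _
  have m0 : |Jet.eta (D.J x) x t y| * |Jet.psiJ (D.J x) D.s x y| ≤ B ^ 2 * D.κ ^ (1 / 2 : ℝ) * D.μ := by
    calc _ ≤ (B * D.κ ^ (1 / 2 : ℝ)) * (B * D.μ) := mul_le_mul e0 p0 (abs_nonneg _) (by positivity)
      _ = _ := by ring
  have m1 : |Jet.etaD (D.J x) x t y| * |Jet.psiJ (D.J x) D.s x y| ≤ B ^ 2 * D.κ ^ (3 / 2 : ℝ) * D.μ := by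
    calc _ ≤ (B * D.κ ^ (3 / 2 : ℝ)) * (B * D.μ) := mul_le_mul e1 p0 (abs_nonneg _) (by positivity)
      _ = _ := by ring
  have m3 : |Jet.etaD (D.J x) x t y| * ∑ j, |Torus.partialDeriv j (Jet.phiJ (D.J x) D.s x) y| ≤ 3 * B ^ 2 * D.κ ^ (3 / 2 : ℝ) * (D.σ : ℝ)⁻¹ := by
    calc _ ≤ (B * D.κ ^ (3 / 2 : ℝ)) * (3 * (B * (D.σ : ℝ)⁻¹)) := mul_le_mul e1 hSφ hS0 (by positivity)
      _ = _ := by ring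
  have m4 : |Jet.etaDD (D.J x) x t y| * ∑ j, |Torus.partialDeriv j (Jet.phiJ (D.J x) D.s x) y| ≤ 3 * B ^ 2 * D.κ ^ (5 / 2 : ℝ) * (D.σ : ℝ)⁻¹ := by
    calc _ ≤ (B * D.κ ^ (5 / 2 : ℝ)) * (3 * (B * (D.σ : ℝ)⁻¹)) := mul_le_mul e2 hSφ hS0 (by positivity)
      _ = _ := by ring
  have m7 : |Jet.eta (D.J x) x t y| * ∑ j, |Torus.partialDeriv j (Jet.phiJ (D.J x) D.s x) y| ≤ 3 * B ^ 2 * D.κ ^ (1 / 2 : ℝ) * (D.σ : ℝ)⁻¹ := by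
    calc _ ≤ (B * D.κ ^ (1 / 2 : ℝ)) * (3 * (B * (D.σ : ℝ)⁻¹)) := mul_le_mul e0 hSφ hS0 (by positivity)
      _ = _ := by ring
  have hσ0 : (0 : ℝ) ≤ D.σ := hσ.le
  nlinarith [mul_le_mul_of_nonneg_left m0 (by positivity : (0:ℝ) ≤ 3 * A₁),
    mul_le_mul_of_nonneg_left m1 (by positivity : (0:ℝ) ≤ 15 * D.σ * D.mup * A₀),
    mul_le_mul_of_nonneg_left m3 (by positivity : (0:ℝ) ≤ (5 * D.σ + 60 * D.σ * D.mup) * A₁),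
    mul_le_mul_of_nonneg_left m4 (by positivity : (0:ℝ) ≤ 25 * D.σ ^ 2 * D.mup * A₀),
    mul_le_mul_of_nonneg_left m7 (by positivity : (0:ℝ) ≤ 12 * A₂)]

/-! ## `∂ₜX` -/

/-- **Sup bound of `Ḟ = ∂ₜF`**: `|Ḟ| ≤ H₁B⁴κμ² + 10σμ′A₀²B⁴κ²μ²`. [folklore] -/
theorem abs_Fdot_le (x : Idx) {t : ℝ} (ht : t ∈ Icc 0 D.T) (y : 𝕋³) :
    |D.Fdot x t y| ≤ H₁ * (B ^ 4 * D.κ * D.μ ^ 2) + 10 * D.σ * D.mup * A₀ ^ 2 * (B ^ 4 * D.κ ^ 2 * D.μ ^ 2) := by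
  obtain ⟨hμ, hκ, hσ, hmup, hμ1, hκ1, -⟩ := pos h
  have hA0 := hA.hA₀; have hH1 := hA.hH₁
  have hB0 : 0 ≤ B := by linarith
  have hJμ : (D.J x).μ = D.μ := rfl
  have hJκ : (D.J x).κ = D.κ := rfl
  rw [Fdot_eq h x ht y, dirD_fastF h x t y]
  have hf0 : 0 ≤ Jet.fastF (D.J x) D.s x t y := by unfold Jet.fastF; positivity
  have hhs := hsq_le h hA x ht y
  have hfast : Jet.fastF (D.J x) D.s x t y ≤ B ^ 4 * D.κ * D.μ ^ 2 := by
    have e0 := (hB x t).eta_le y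
    have p0 := (hB x t).psiJ_le y
    simp only [hJμ, hJκ] at e0 p0
    have e1 : Jet.fastF (D.J x) D.s x t y = |Jet.eta (D.J x) x t y| ^ 2 * |Jet.psiJ (D.J x) D.s x y| ^ 2 := by rw [Jet.fastF, sq_abs, sq_abs]
    have hκ' : (D.κ ^ (1 / 2 : ℝ)) ^ 2 = D.κ := by rw [← Real.rpow_natCast, ← Real.rpow_mul hκ.le]; norm_num
    rw [e1]
    calc |Jet.eta (D.J x) x t y| ^ 2 * |Jet.psiJ (D.J x) D.s x y| ^ 2 ≤ (B * D.κ ^ (1 / 2 : ℝ)) ^ 2 * (B * D.μ) ^ 2 :=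
          mul_le_mul (pow_le_pow_left₀ (abs_nonneg _) e0 2) (pow_le_pow_left₀ (abs_nonneg _) p0 2) (by positivity) (by positivity)
      _ = B ^ 4 * D.κ * D.μ ^ 2 := by rw [mul_pow, hκ']; ring
  have hb1 : |Jet.eta (D.J x) x t y * Jet.etaD (D.J x) x t y| * Jet.psiJ (D.J x) D.s x y ^ 2 ≤ B ^ 4 * D.κ ^ 2 * D.μ ^ 2 := by
    have e0 := (hB x t).eta_le y
    have e1 := (hB x t).etaD_le y
    have p0 := (hB x t).psiJ_le y
    simp only [hJμ, hJκ] at e0 e1 p0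
    have hκ' : D.κ ^ (1 / 2 : ℝ) * D.κ ^ (3 / 2 : ℝ) = D.κ ^ 2 := by
      rw [← Real.rpow_add hκ, show (1 / 2 : ℝ) + 3 / 2 = 2 by norm_num, Real.rpow_two]
    rw [abs_mul, ← sq_abs (Jet.psiJ _ _ _ _)]
    calc |Jet.eta (D.J x) x t y| * |Jet.etaD (D.J x) x t y| * |Jet.psiJ (D.J x) D.s x y| ^ 2
        ≤ (B * D.κ ^ (1 / 2 : ℝ)) * (B * D.κ ^ (3 / 2 : ℝ)) * (B * D.μ) ^ 2 :=
          mul_le_mul (mul_le_mul e0 e1 (abs_nonneg _) (by positivity)) (pow_le_pow_left₀ (abs_nonneg _) p0 2) (by positivity) (by positivity)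
      _ = B ^ 4 * D.κ ^ 2 * D.μ ^ 2 := by rw [show (B * D.κ ^ (1 / 2 : ℝ)) * (B * D.κ ^ (3 / 2 : ℝ)) = B ^ 2 * (D.κ ^ (1 / 2 : ℝ) * D.κ ^ (3 / 2 : ℝ)) by ring, hκ']; ring
  have hd5 := dirNormSq_le' x
  have hd0 := (dirNormSq_pos x).le
  refine (abs_add_le _ _).trans (add_le_add ?_ ?_)
  · rw [abs_mul, abs_of_nonneg hf0]
    exact mul_le_mul (hA.dth_le x t ht y) hfast hf0 hH1
  · rw [abs_mul, abs_of_nonneg hhs.1, abs_mul, abs_of_nonneg hmup.le]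
    have h2 : |2 * ((D.σ : ℝ) * dirNormSq x) * (Jet.eta (D.J x) x t y * Jet.etaD (D.J x) x t y) * Jet.psiJ (D.J x) D.s x y ^ 2| ≤
        10 * D.σ * (B ^ 4 * D.κ ^ 2 * D.μ ^ 2) := by
      rw [abs_mul, abs_mul, abs_mul, abs_of_nonneg (sq_nonneg (Jet.psiJ (D.J x) D.s x y)), abs_two, abs_of_nonneg (by positivity : (0:ℝ) ≤ (D.σ : ℝ) * dirNormSq x)]
      calc 2 * (↑D.σ * dirNormSq x) * |Jet.eta (D.J x) x t y * Jet.etaD (D.J x) x t y| * Jet.psiJ (D.J x) D.s x y ^ 2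
          ≤ 2 * (↑D.σ * 5) * (B ^ 4 * D.κ ^ 2 * D.μ ^ 2) := by
            rw [mul_assoc (2 * (↑D.σ * dirNormSq x))]
            exact mul_le_mul (by gcongr) hb1 (by positivity) (by positivity)
        _ = _ := by ring
    calc JAmp.hsq D.γ₀ D.M x t y * (D.mup * |2 * (↑D.σ * dirNormSq x) * (Jet.eta (D.J x) x t y * Jet.etaD (D.J x) x t y) * Jet.psiJ (D.J x) D.s x y ^ 2|)
        ≤ A₀ ^ 2 * (D.mup * (10 * D.σ * (B ^ 4 * D.κ ^ 2 * D.μ ^ 2))) := by gcongr; exact hhs.2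
      _ = _ := by ring

/-- **Sup bound of `∂ₜX`**: `‖∂ₜX‖ ≤ 6Nμ′⁻¹ sup|Ḟ|`. [cite: BuckmasterVicol2019Annals, §2 (2.3)] -/
theorem norm_timeDerivWithin_X_le_sup {t : ℝ} (ht : t ∈ Icc 0 D.T) (y : 𝕋³) :
    ‖Torus.timeDerivWithin (Icc 0 D.T) D.X t y‖ ≤ NN * (6 * D.mup⁻¹ *
      (H₁ * (B ^ 4 * D.κ * D.μ ^ 2) + 10 * D.σ * D.mup * A₀ ^ 2 * (B ^ 4 * D.κ ^ 2 * D.μ ^ 2))) := by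
  have hmup := (pos h).2.2.2.1
  rw [timeDerivWithin_X h ht y, norm_neg]
  refine (norm_sum_le _ _).trans (sum_le_NN_mul fun x => ?_)
  have hF := fun z => abs_Fdot_le h hA hB hB1 x ht z
  set Q := H₁ * (B ^ 4 * D.κ * D.μ ^ 2) + 10 * D.σ * D.mup * A₀ ^ 2 * (B ^ 4 * D.κ ^ 2 * D.μ ^ 2)
  have hQ0 : 0 ≤ Q := (abs_nonneg _).trans (hF y)
  have hint : |∫ z, D.Fdot x t z| ≤ Q := by
    have h1 : |∫ z, D.Fdot x t z| ≤ ∫ z, ‖D.Fdot x t z‖ := by rw [← Real.norm_eq_abs]; exact norm_integral_le_integral_norm _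
    refine h1.trans ((integral_mono_of_nonneg (Eventually.of_forall fun z => norm_nonneg _) (integrable_const Q)
      (Eventually.of_forall fun z => by simp only [Real.norm_eq_abs]; exact hF z)).trans ?_)
    simp
  rw [norm_smul, Real.norm_eq_abs, abs_mul, abs_of_pos (inv_pos.2 hmup)]
  calc D.mup⁻¹ * |D.Fdot x t y - ∫ z, D.Fdot x t z| * ‖dirVec x‖ ≤ D.mup⁻¹ * (Q + Q) * 3 := by
        refine mul_le_mul (mul_le_mul_of_nonneg_left ((abs_sub _ _).trans (add_le_add (hF y) hint)) (by positivity))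
          (CL22.norm_dirVec_le x) (norm_nonneg _) (by positivity)
    _ = 6 * D.mup⁻¹ * Q := by ring

end Datum

end JetStep

end Literature.Analysis.FluidPDE
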